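import Summits.QuantumFields.YangMills.Theorems.TwistExponentGapOrbitTubeVolume
import HarnessLib

/-!
# Volume of a GAUGE-orbit tube in a product of compact matrix groups
# (helper toward the crux `TwistExponentGap.RigidTwistCeiling` ⟨stmt-QuantumFields-24054⟩; also serves ⟨24053⟩)

The landed `TwistExponentGap.orbitTube_measureReal_le` (✓p756002) bounds the Haar volume of the `r`-tube around a
CONJUGATION orbit `{(g W_e g⁻¹)_e}` (one group element acting on all coordinates — the residual global gauge group
after a maximal-tree gauge fixing).  This file proves the same bound for the orbit of a FULL LATTICE GAUGE GROUP
`G^κ` acting on link variables `V : ι → G` by `V_e ↦ g(s e) · V_e · g(t e)⁻¹` (`s t : ι → κ` the endpoints of the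
link `e`; on the torus `s e = e.1`, `t e = e.1.shift e.2`, tree `gaugeTransform`), with no gauge fixing at all:

  `Haar^ι { V | ∃ g : κ → G, ∀ e, ‖ρ(V e) − ρ(g(s e) W_e g(t e)⁻¹)‖ ≤ r } ≤ C · r^{D·(|ι| − |κ|)}`   (`0 < r ≤ 1`),

`D = dimE ρ`, `C` independent of the centre `W` (`gaugeOrbitTube_measureReal_le`; natural-number exponent, truncated
subtraction).  Mechanism (as in the conjugation case): an `r`-net `T ⊂ G` with `|T|·Haar(B_{r/2}) ≤ 1` (tree
`exists_net`) gives the product net `T^κ` of the gauge group; the action is `1`-Lipschitz in each of the two acting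
group elements (Hilbert–Schmidt norm, unitary `ρ`), so the tube lies in `|T|^{|κ|}` product boxes of radius `3r`, each
of mass `≤ (c₂(3r)^D)^{|ι|}` (tree `exists_haar_gball_le`), while `|T|^{|κ|} ≤ (2^D/(c₁r^D))^{|κ|}` (tree
`exists_haar_gball_ge`): `|κ|` factors `r^D` cancel.  With `|ι| = 4S⁴` links and `|κ| = S⁴` sites of the side-`S`
four-torus the exponent is `3S⁴·D = (3S⁴ − 1)·D + D`, i.e. the crux's `(3S⁴−1)D/2 + δ` at `δ = D/2` after the
square root of the Morse–Bott inequality (companion file `TwistExponentGapRigidCeilingOfMorseBott`).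
HONEST FRAMING: measure-theoretic bookkeeping only; the Morse–Bott inequality (the content of ⟨24054⟩) is NOT proved
here; nothing here bears on a summit statement or on the Yang–Mills mass gap.  THEOREMS ONLY, standard axioms.
-/

set_option autoImplicit false

noncomputable section

open scoped Matrix.Norms.Frobenius ENNReal BigOperators
open MeasureTheory
open Literature.MathematicalPhysics.QuantumFieldTheory
open Summit.QuantumFields.YangMills.Theorems.FreeEnergyLogCoefficient (dimE exists_haar_gball_ge haar_setOf_norm_sub_le)
open Summit.QuantumFields.YangMills.Theorems.FemtoCurvatureTwoPointC (exists_haar_gball_le)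

namespace Summit.QuantumFields.YangMills.Theorems.TwistExponentGap

variable {G : Type*} [Group G] [TopologicalSpace G] [IsTopologicalGroup G] [CompactSpace G]
  [MeasurableSpace G] [BorelSpace G] {N : ℕ} (ρ : G →* Matrix (Fin N) (Fin N) ℂ)

omit [TopologicalSpace G] [IsTopologicalGroup G] [CompactSpace G] [MeasurableSpace G] [BorelSpace G] in
/-- For a unitary representation, `ρ x⁻¹ = (ρ x)ᴴ`. -/
theorem rho_inv_eq_conjTranspose (hU : ∀ g, ρ g ∈ Matrix.unitaryGroup (Fin N) ℂ) (x : G) :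
    ρ x⁻¹ = (ρ x).conjTranspose := by
  have h1 : ρ x⁻¹ * ρ x = 1 := by rw [← map_mul, inv_mul_cancel, map_one]
  have h2 : ρ x * star (ρ x) = 1 := Matrix.mem_unitaryGroup_iff.1 (hU x)
  rw [← Matrix.star_eq_conjTranspose]
  calc ρ x⁻¹ = (ρ x)⁻¹ := (Matrix.inv_eq_left_inv h1).symm
    _ = star (ρ x) := Matrix.inv_eq_right_inv h2

omit [TopologicalSpace G] [IsTopologicalGroup G] [CompactSpace G] [MeasurableSpace G] [BorelSpace G] in
/-- **The two-sided action is `1`-Lipschitz in each acting variable** (Hilbert–Schmidt norm, unitary `ρ`):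
`‖ρ(a W b⁻¹) − ρ(a' W b'⁻¹)‖ ≤ ‖ρ a − ρ a'‖ + ‖ρ b − ρ b'‖`. -/
theorem norm_act_sub_act_le (hU : ∀ g, ρ g ∈ Matrix.unitaryGroup (Fin N) ℂ) (a a' b b' W : G) :
    ‖ρ (a * W * b⁻¹) - ρ (a' * W * b'⁻¹)‖ ≤ ‖ρ a - ρ a'‖ + ‖ρ b - ρ b'‖ := by
  have e : ρ (a * W * b⁻¹) - ρ (a' * W * b'⁻¹) =
      (ρ a - ρ a') * (ρ W * ρ b⁻¹) + ρ a' * ρ W * (ρ b⁻¹ - ρ b'⁻¹) := by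
    simp only [map_mul]; noncomm_ring
  have h1 : ‖(ρ a - ρ a') * (ρ W * ρ b⁻¹)‖ = ‖ρ a - ρ a'‖ := by
    rw [← map_mul]
    exact Matrix.frobenius_norm_mul_unitaryGroup (ρ a - ρ a') ⟨ρ (W * b⁻¹), hU _⟩
  have h2 : ‖ρ a' * ρ W * (ρ b⁻¹ - ρ b'⁻¹)‖ = ‖ρ b⁻¹ - ρ b'⁻¹‖ := by
    rw [← map_mul]
    exact Matrix.frobenius_norm_unitaryGroup_mul ⟨ρ (a' * W), hU _⟩ (ρ b⁻¹ - ρ b'⁻¹)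
  have h3 : ‖ρ b⁻¹ - ρ b'⁻¹‖ = ‖ρ b - ρ b'‖ := by
    rw [rho_inv_eq_conjTranspose ρ hU b, rho_inv_eq_conjTranspose ρ hU b', ← Matrix.conjTranspose_sub,
      Matrix.frobenius_norm_conjTranspose]
  calc ‖ρ (a * W * b⁻¹) - ρ (a' * W * b'⁻¹)‖
      = ‖(ρ a - ρ a') * (ρ W * ρ b⁻¹) + ρ a' * ρ W * (ρ b⁻¹ - ρ b'⁻¹)‖ := by rw [e]
    _ ≤ ‖(ρ a - ρ a') * (ρ W * ρ b⁻¹)‖ + ‖ρ a' * ρ W * (ρ b⁻¹ - ρ b'⁻¹)‖ := norm_add_le _ _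
    _ = ‖ρ a - ρ a'‖ + ‖ρ b - ρ b'‖ := by rw [h1, h2, h3]

/-- **Volume of a gauge-orbit tube.** For a compact group `G` with a faithful unitary representation `ρ` (`D = dimE ρ`),
finite index types `ι` (links) and `κ` (sites) and endpoint maps `s t : ι → κ` there is `C > 0` such that for EVERY centre
`W : ι → G` and every `0 < r ≤ 1`,
`Haar^ι {V | ∃ g : κ → G, ∀ e, ‖ρ(V e) − ρ(g (s e) · W e · (g (t e))⁻¹)‖ ≤ r} ≤ C · r^{D(|ι|−|κ|)}`
(natural-number exponent with truncated subtraction; for `|ι| ≤ |κ|` the bound is the trivial `≤ C`). -/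
theorem gaugeOrbitTube_measureReal_le {ι κ : Type*} [Fintype ι] [Fintype κ] (s t : ι → κ)
    (hρ : Continuous ρ) (hinj : Function.Injective ρ) (hU : ∀ g, ρ g ∈ Matrix.unitaryGroup (Fin N) ℂ) :
    ∃ C : ℝ, 0 < C ∧ ∀ (W : ι → G) (r : ℝ), 0 < r → r ≤ 1 →
      (Measure.pi fun _ : ι => haarProbability G).real
          {V : ι → G | ∃ g : κ → G, ∀ e, ‖ρ (V e) - ρ (g (s e) * W e * (g (t e))⁻¹)‖ ≤ r} ≤
        C * r ^ (dimE ρ * (Fintype.card ι - Fintype.card κ)) := by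
  classical
  haveI : IsProbabilityMeasure (haarProbability G) := inferInstance
  obtain ⟨c₁, hc₁, hlow⟩ := exists_haar_gball_ge ρ hρ hinj hU
  obtain ⟨c₂, hc₂, hup⟩ := exists_haar_gball_le ρ hρ hinj hU
  set D : ℕ := dimE ρ with hD
  set I : ℕ := Fintype.card ι with hI
  set K : ℕ := Fintype.card κ with hK
  -- the constant
  set C : ℝ := ((2 : ℝ) ^ D / c₁) ^ K * (c₂ * 3 ^ D) ^ I + 1 with hC
  have hC0 : 0 < C := by positivity
  refine ⟨C, hC0, fun W r hr hr1 => ?_⟩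
  set μ := (Measure.pi fun _ : ι => haarProbability G) with hμ
  haveI : IsProbabilityMeasure μ := by rw [hμ]; infer_instance
  -- small-ball floor at `r/2` (real form)
  have hv : c₁ * (r / 2) ^ D ≤ (haarProbability G).real {g : G | ‖ρ g - 1‖ ≤ r / 2} := by
    have h := hlow (r / 2) (by positivity) (by linarith)
    rw [Measure.real]
    exact (ENNReal.ofReal_le_iff_le_toReal (measure_ne_top _ _)).1 h
  have hvpos : 0 < (haarProbability G).real {g : G | ‖ρ g - 1‖ ≤ r / 2} := lt_of_lt_of_le (by positivity) hv
  obtain ⟨T, hTcard, hnet⟩ := exists_net ρ hρ hU hvpos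
  -- `|T| ≤ 2^D/(c₁ r^D)`
  have hT : (T.card : ℝ) ≤ (2 : ℝ) ^ D / c₁ * (r ^ D)⁻¹ := by
    have h1 : (T.card : ℝ) * (c₁ * (r / 2) ^ D) ≤ 1 :=
      (mul_le_mul_of_nonneg_left hv (Nat.cast_nonneg _)).trans hTcard
    have hpos : 0 < c₁ * (r / 2) ^ D := by positivity
    rw [← le_div_iff₀ hpos] at h1
    refine h1.trans (le_of_eq ?_)
    rw [div_pow]; field_simp
  -- the product net of the gauge group
  set Tκ : Finset (κ → G) := Fintype.piFinset fun _ : κ => T with hTκ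
  have hTκcard : (Tκ.card : ℝ) = (T.card : ℝ) ^ K := by
    rw [hTκ, Fintype.card_piFinset, Finset.prod_const, Finset.card_univ, hK, Nat.cast_pow]
  -- the tube is covered by the boxes around the net gauge transforms of `W`
  set box : (κ → G) → Set (ι → G) := fun τ =>
    Set.pi Set.univ fun e => {v : G | ‖ρ v - ρ (τ (s e) * W e * (τ (t e))⁻¹)‖ ≤ 3 * r} with hbox
  have hcover : {V : ι → G | ∃ g : κ → G, ∀ e, ‖ρ (V e) - ρ (g (s e) * W e * (g (t e))⁻¹)‖ ≤ r} ⊆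
      ⋃ τ ∈ Tκ, box τ := by
    rintro V ⟨g, hg⟩
    choose τ hτT hτ using fun x : κ => hnet (g x)
    have hτmem : τ ∈ Tκ := by
      rw [hTκ, Fintype.mem_piFinset]; exact hτT
    refine Set.mem_biUnion (Finset.mem_coe.2 hτmem) ?_
    rw [hbox]; simp only [Set.mem_pi, Set.mem_univ, Set.mem_setOf_eq, forall_true_left]
    intro e
    calc ‖ρ (V e) - ρ (τ (s e) * W e * (τ (t e))⁻¹)‖
        = ‖(ρ (V e) - ρ (g (s e) * W e * (g (t e))⁻¹)) +
            (ρ (g (s e) * W e * (g (t e))⁻¹) - ρ (τ (s e) * W e * (τ (t e))⁻¹))‖ := by congr 1; abel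
      _ ≤ ‖ρ (V e) - ρ (g (s e) * W e * (g (t e))⁻¹)‖ +
            ‖ρ (g (s e) * W e * (g (t e))⁻¹) - ρ (τ (s e) * W e * (τ (t e))⁻¹)‖ := norm_add_le _ _
      _ ≤ r + (‖ρ (g (s e)) - ρ (τ (s e))‖ + ‖ρ (g (t e)) - ρ (τ (t e))‖) :=
          add_le_add (hg e) (norm_act_sub_act_le ρ hU _ _ _ _ (W e))
      _ ≤ r + (r + r) := by gcongr <;> exact hτ _
      _ = 3 * r := by ring
  -- mass of one box
  have hbox_le : ∀ τ : κ → G, μ.real (box τ) ≤ (c₂ * (3 * r) ^ D) ^ I := by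
    intro τ
    rw [Measure.real, hμ, hbox]; dsimp only
    rw [Measure.pi_pi]
    have heach : ∀ e : ι, haarProbability G {v : G | ‖ρ v - ρ (τ (s e) * W e * (τ (t e))⁻¹)‖ ≤ 3 * r} ≤
        ENNReal.ofReal (c₂ * (3 * r) ^ D) := fun e => by
      rw [haar_setOf_norm_sub_le ρ hU]; exact hup (3 * r) (by positivity)
    have hprod : (∏ e : ι, haarProbability G {v : G | ‖ρ v - ρ (τ (s e) * W e * (τ (t e))⁻¹)‖ ≤ 3 * r}) ≤
        ∏ _e : ι, ENNReal.ofReal (c₂ * (3 * r) ^ D) := Finset.prod_le_prod' fun e _ => heach e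
    rw [Finset.prod_const, Finset.card_univ] at hprod
    have hne : (ENNReal.ofReal (c₂ * (3 * r) ^ D)) ^ I ≠ ⊤ := ENNReal.pow_ne_top ENNReal.ofReal_ne_top
    calc (∏ e : ι, haarProbability G {v : G | ‖ρ v - ρ (τ (s e) * W e * (τ (t e))⁻¹)‖ ≤ 3 * r}).toReal
        ≤ ((ENNReal.ofReal (c₂ * (3 * r) ^ D)) ^ I).toReal := ENNReal.toReal_mono hne hprod
      _ = (c₂ * (3 * r) ^ D) ^ I := by rw [ENNReal.toReal_pow, ENNReal.toReal_ofReal (by positivity)]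
  -- union bound
  have hunion : μ.real (⋃ τ ∈ Tκ, box τ) ≤ ∑ τ ∈ Tκ, μ.real (box τ) := measureReal_biUnion_finset_le Tκ box
  have hmain : μ.real {V : ι → G | ∃ g : κ → G, ∀ e, ‖ρ (V e) - ρ (g (s e) * W e * (g (t e))⁻¹)‖ ≤ r} ≤
      ((2 : ℝ) ^ D / c₁ * (r ^ D)⁻¹) ^ K * (c₂ * (3 * r) ^ D) ^ I := by
    calc μ.real {V : ι → G | ∃ g : κ → G, ∀ e, ‖ρ (V e) - ρ (g (s e) * W e * (g (t e))⁻¹)‖ ≤ r}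
        ≤ μ.real (⋃ τ ∈ Tκ, box τ) := measureReal_mono hcover (measure_ne_top μ _)
      _ ≤ ∑ τ ∈ Tκ, μ.real (box τ) := hunion
      _ ≤ ∑ _τ ∈ Tκ, (c₂ * (3 * r) ^ D) ^ I := Finset.sum_le_sum fun τ _ => hbox_le τ
      _ = Tκ.card * (c₂ * (3 * r) ^ D) ^ I := by rw [Finset.sum_const, nsmul_eq_mul]
      _ = (T.card : ℝ) ^ K * (c₂ * (3 * r) ^ D) ^ I := by rw [hTκcard]
      _ ≤ ((2 : ℝ) ^ D / c₁ * (r ^ D)⁻¹) ^ K * (c₂ * (3 * r) ^ D) ^ I := by gcongr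
  -- arithmetic: `r^{-D K} · r^{D I} = r^{D (I - K)}` when `K ≤ I`; probability bound when `I < K`
  have hrD : 0 < r ^ D := pow_pos hr D
  rcases le_or_gt K I with hKI | hIK
  · have key : ((2 : ℝ) ^ D / c₁ * (r ^ D)⁻¹) ^ K * (c₂ * (3 * r) ^ D) ^ I =
        ((2 : ℝ) ^ D / c₁) ^ K * (c₂ * 3 ^ D) ^ I * r ^ (D * (I - K)) := by
      obtain ⟨J, hJ⟩ : ∃ J, I = K + J := ⟨I - K, by omega⟩
      rw [hJ, Nat.add_sub_cancel_left, mul_pow (3 : ℝ) r D, ← mul_assoc c₂, mul_pow (c₂ * 3 ^ D) (r ^ D),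
        pow_add (r ^ D) K J, ← pow_mul, mul_pow ((2 : ℝ) ^ D / c₁) ((r ^ D)⁻¹) K, inv_pow]
      have hrDK : (r ^ D) ^ K ≠ 0 := pow_ne_zero _ hrD.ne'
      field_simp
      ring
    rw [key] at hmain
    refine hmain.trans ?_
    have hrpow : 0 ≤ r ^ (D * (I - K)) := pow_nonneg hr.le _
    have : ((2 : ℝ) ^ D / c₁) ^ K * (c₂ * 3 ^ D) ^ I ≤ C := by rw [hC]; linarith
    exact mul_le_mul_of_nonneg_right this hrpow
  · -- `I < K`: probability bound
    have h1 : μ.real {V : ι → G | ∃ g : κ → G, ∀ e, ‖ρ (V e) - ρ (g (s e) * W e * (g (t e))⁻¹)‖ ≤ r} ≤ 1 :=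
      measureReal_le_one
    have hIK0 : I - K = 0 := by omega
    rw [hIK0, mul_zero, pow_zero, mul_one]
    have : (1 : ℝ) ≤ C := by
      rw [hC]; have : 0 ≤ ((2 : ℝ) ^ D / c₁) ^ K * (c₂ * 3 ^ D) ^ I := by positivity
      linarith
    linarith

end Summit.QuantumFields.YangMills.Theorems.TwistExponentGap

end
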